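/-
Origin: expansion seat `planner-pub-hodgecm-pv11-g9-0`, handover ONE rewrite: `^import Pv11g9\.` -> `import HodgeCM.PerL34.` (x1: `import Pv11g9.PrintedSmoothEndState7` -> `import HodgeCM.PerL34.PrintedSmoothEndState7`, my RUN-31 row 1 55cbec01); `import HodgeCM.PerL34.OpenInputsN19AllChars` is pv08-g13's RUN-30 tree file (723b5e8f), unchanged ; after RUN 30 lands PerL34/OpenInputsN19AllChars + PerL34/PrintedSmoothEndState, and after my RUN-31 row 1 (PrintedSmo (`HOME/pub-hodgecm-pv11-g9/lean/Pv11g9/PrintedSmoothEndStateCores.lean`, md5 0c1ed4f3, 175 lines);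
landed by the gen-8 packager in gate run 31 as `HodgeCM/PerL34/PrintedSmoothEndStateCores.lean` (import ^import Pv11g9\.PrintedSmoothEndState7[ \t]*$→import HodgeCM.PerL34.PrintedSmoothEndState7 ×1).
-/
/-
Copyright: pub-hodgecm cell, unit pub-hodgecm-pv11-g9 (DAG-NODE PROVER #11, gen 9), node #9. Mathlib + tree only.
Origin / target: `HOME/pub-hodgecm-pv11-g9/lean/Pv11g9/PrintedSmoothEndStateCores.lean` → `HodgeCM/PerL34/PrintedSmoothEndStateCores.lean`
(imports this seat's node #8 `Pv11g9.PrintedSmoothEndState7` → tree `HodgeCM.PerL34.PrintedSmoothEndState7`, rewrite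
`^import Pv11g9\.` ↦ `import HodgeCM.PerL34.`; plus pv08-g13's RUN-30 tree file `HodgeCM.PerL34.OpenInputsN19AllChars`).
-/
import Summits.HodgeConjecture.HodgeCM.PerL34.PrintedSmoothEndState7
import Summits.HodgeConjecture.HodgeCM.PerL34.OpenInputsN19AllChars

/-!
# The END STATE with every available residual form at once: N19 cores (pv08) + N29 from nine 𝒯-free fields (pv11)

Junction by modus ponens (suggested by pv08-g13, STATUS 14:35:41Z) of
* pv08-g11/g13 `HodgeCM/PerL34/OpenInputsN19AllChars.lean`: the two N19 binders of the all-characters END STATE in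
  RESIDUAL-CORE form — `thetaGen12All` from the (12)-side seesaw-generator identity `N19w_genIdentity … (T.t12 V c) 0 1`
  (`ThetaModel.open_thetaGen12All_of_genIdentity`) and `thetaReal34All` from the (34)-side finite-sum core for every
  character `N19g_coreAll … (T.t34 V c) 2 3` (`ThetaModel.open_thetaReal34All_of_coreAll`); packaged as
  `ThetaModel.CoresNonDesign` = {embCover, innerEmb, thetaSub, thetaWedge, genIdentity12, coreAll34, occ};
* this seat's node #6/#8 (`PrintedSmoothEndState`, `PrintedSmoothEndState7`): `occ` (N29) of the sign-recipe END-STATE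
  model `C.thetaModel h d12 d34` from a `LinearStr` instance per Weil theta model and the nine-field 𝒯-free records
  `LinSmoothCore12/34` (`AdelicThetaCore.Open_occ_thetaModel_of_linSmoothCores`).

Result: `AdelicThetaCore.coresNonDesign_thetaModel_of_linSmoothCores` — `(C.thetaModel h d12 d34).CoresNonDesign` from
FOUR verbatim inputs {embCover, innerEmb [PRINT], thetaSub (N12), thetaWedge (N33)} + the two N19 cores + (`lin`, `A12`,
`A34`); and the END STATES `Assembly.realisationExists_ofSignRecipe₇_ofCores_linSmooth` /
`perL_ofSignRecipe₇_ofCores_linSmooth : … → U.PerL` / `COR_CM_endState_ofSignRecipe₇_ofCores_linSmooth : … → U.HC_CM`.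
Honest label: reshaping only; the residuals are exactly the union of pv08's (the two cores, GAPS pv08/N19, pv08g11-K1)
and pv11's (CONSTRUCTION of an adelic linear Weil theta model with the nine fields, GAPS pv11g9-A7).  Nothing is
posited, nothing is cited.
-/

noncomputable section

namespace HodgeCM

namespace Universe

namespace AdelicThetaCore

open HodgeCM.PerL34

variable {U : Universe} {hP : PrintFact_unitaryCompact} (C₀ : U.AdelicThetaCore hP) (h : Bool)
  (d12 d34 : ∀ {L : CMField}, SeesawCtx L → SideData L)

/-- **`CoresNonDesign` of the sign-recipe END-STATE model from four verbatim inputs, the two N19 cores and the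
𝒯-free linear cores** (`occ := Open_occ_thetaModel_of_linSmoothCores`). -/
theorem coresNonDesign_thetaModel_of_linSmoothCores
    (lin : ∀ {L : CMField} {ι₁ : L →+* ℂ} (V : HermSpace3 L ι₁) (c : SeesawCtx L), ((C₀.toCore h).wm V c).LinearStr)
    (embCover : (C₀.thetaModel h d12 d34).Fact_embCover) (innerEmb : (C₀.thetaModel h d12 d34).Fact_innerEmb)
    (thetaSub : (C₀.thetaModel h d12 d34).Open_thetaSub) (thetaWedge : (C₀.thetaModel h d12 d34).Open_thetaWedge)
    (genIdentity12 : ∀ {L : CMField} {ι₁ : L →+* ℂ} (V : HermSpace3 L ι₁) (c : SeesawCtx L),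
      (C₀.thetaModel h d12 d34).GoodCtx ι₁ c →
        N19w_genIdentity (C₀.thetaModel h d12 d34) V c ((C₀.thetaModel h d12 d34).t12 V c) 0 1)
    (coreAll34 : ∀ {L : CMField} {ι₁ : L →+* ℂ} (V : HermSpace3 L ι₁) (c : SeesawCtx L),
      (C₀.thetaModel h d12 d34).GoodCtx ι₁ c →
        N19g_coreAll (C₀.thetaModel h d12 d34) V c ((C₀.thetaModel h d12 d34).t34 V c) 2 3)
    (A12 : ∀ {L : CMField} {ι₁ : L →+* ℂ} (V : HermSpace3 L ι₁) (c : SeesawCtx L),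
      (C₀.thetaModel h d12 d34).GoodCtx ι₁ c →
        Nonempty ((C₀.toCore h).LinSmoothCore12 ((C₀.toCore h).side12 d12) ((C₀.toCore h).side34 d34)
          ((C₀.toCore h).analyticKM ((C₀.toCore h).side12 d12) ((C₀.toCore h).side34 d34)).toAnalytic V c
          (ℓ := lin V c)))
    (A34 : ∀ {L : CMField} {ι₁ : L →+* ℂ} (V : HermSpace3 L ι₁) (c : SeesawCtx L),
      (C₀.thetaModel h d12 d34).GoodCtx ι₁ c →
        Nonempty ((C₀.toCore h).LinSmoothCore34 ((C₀.toCore h).side12 d12) ((C₀.toCore h).side34 d34)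
          ((C₀.toCore h).analyticKM ((C₀.toCore h).side12 d12) ((C₀.toCore h).side34 d34)).toAnalytic V c
          (ℓ := lin V c))) :
    (C₀.thetaModel h d12 d34).CoresNonDesign :=
  ⟨embCover, innerEmb, thetaSub, thetaWedge, genIdentity12, coreAll34,
    C₀.Open_occ_thetaModel_of_linSmoothCores h d12 d34 lin A12 A34⟩

end AdelicThetaCore

end Universe

/-! ## END STATES, cores form (pv08) with `occ` from the nine 𝒯-free fields (pv11) -/

namespace Assembly

open HodgeCM.PerL34
open HodgeCM.Universe (AdelicThetaCore AdelicThetaCore₀ SideData ThetaModel)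

variable (U : Universe)

/-- **Both realisation inputs of part (a), every residual form applied**: hypotheses = `M`, `h`, `C`, `d12`/`d34`,
`lin`, the FOUR verbatim inputs {embCover, innerEmb, thetaSub, thetaWedge}, the two N19 cores `genIdentity12` /
`coreAll34`, the linear smooth cores `A12`/`A34`, Hodge–Riemann (`realisationExists_ofSignRecipe₇_ofCores` at
`coresNonDesign_thetaModel_of_linSmoothCores`). -/
theorem realisationExists_ofSignRecipe₇_ofCores_linSmooth (M : U.ModelAxioms) (h : Bool) (C : U.AdelicThetaCore₀)
    (d12 d34 : ∀ {L : CMField}, SeesawCtx L → SideData L)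
    (lin : ∀ {L : CMField} {ι₁ : L →+* ℂ} (V : HermSpace3 L ι₁) (c : SeesawCtx L), ((C.toCore h).wm V c).LinearStr)
    (embCover : (C.thetaModel h d12 d34).Fact_embCover) (innerEmb : (C.thetaModel h d12 d34).Fact_innerEmb)
    (thetaSub : (C.thetaModel h d12 d34).Open_thetaSub) (thetaWedge : (C.thetaModel h d12 d34).Open_thetaWedge)
    (genIdentity12 : ∀ {L : CMField} {ι₁ : L →+* ℂ} (V : HermSpace3 L ι₁) (c : SeesawCtx L),
      (C.thetaModel h d12 d34).GoodCtx ι₁ c →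
        N19w_genIdentity (C.thetaModel h d12 d34) V c ((C.thetaModel h d12 d34).t12 V c) 0 1)
    (coreAll34 : ∀ {L : CMField} {ι₁ : L →+* ℂ} (V : HermSpace3 L ι₁) (c : SeesawCtx L),
      (C.thetaModel h d12 d34).GoodCtx ι₁ c →
        N19g_coreAll (C.thetaModel h d12 d34) V c ((C.thetaModel h d12 d34).t34 V c) 2 3)
    (A12 : ∀ {L : CMField} {ι₁ : L →+* ℂ} (V : HermSpace3 L ι₁) (c : SeesawCtx L),
      (C.thetaModel h d12 d34).GoodCtx ι₁ c →
        Nonempty ((C.toCore h).LinSmoothCore12 ((C.toCore h).side12 d12) ((C.toCore h).side34 d34)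
          ((C.toCore h).analyticKM ((C.toCore h).side12 d12) ((C.toCore h).side34 d34)).toAnalytic V c
          (ℓ := lin V c)))
    (A34 : ∀ {L : CMField} {ι₁ : L →+* ℂ} (V : HermSpace3 L ι₁) (c : SeesawCtx L),
      (C.thetaModel h d12 d34).GoodCtx ι₁ c →
        Nonempty ((C.toCore h).LinSmoothCore34 ((C.toCore h).side12 d12) ((C.toCore h).side34 d34)
          ((C.toCore h).analyticKM ((C.toCore h).side12 d12) ((C.toCore h).side34 d34)).toAnalytic V c
          (ℓ := lin V c)))
    (hHR : U.Fact_hodgeRiemann20) : U.RealisationExistsPerL ∧ U.RealisationExistsFace :=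
  realisationExists_ofSignRecipe₇_ofCores U M h C d12 d34
    (C.coresNonDesign_thetaModel_of_linSmoothCores h d12 d34 lin embCover innerEmb thetaSub thetaWedge
      genIdentity12 coreAll34 A12 A34) hHR

/-- **PerL, every residual form applied.** -/
theorem perL_ofSignRecipe₇_ofCores_linSmooth (M : U.ModelAxioms) (h : Bool) (C : U.AdelicThetaCore₀)
    (d12 d34 : ∀ {L : CMField}, SeesawCtx L → SideData L)
    (lin : ∀ {L : CMField} {ι₁ : L →+* ℂ} (V : HermSpace3 L ι₁) (c : SeesawCtx L), ((C.toCore h).wm V c).LinearStr)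
    (embCover : (C.thetaModel h d12 d34).Fact_embCover) (innerEmb : (C.thetaModel h d12 d34).Fact_innerEmb)
    (thetaSub : (C.thetaModel h d12 d34).Open_thetaSub) (thetaWedge : (C.thetaModel h d12 d34).Open_thetaWedge)
    (genIdentity12 : ∀ {L : CMField} {ι₁ : L →+* ℂ} (V : HermSpace3 L ι₁) (c : SeesawCtx L),
      (C.thetaModel h d12 d34).GoodCtx ι₁ c →
        N19w_genIdentity (C.thetaModel h d12 d34) V c ((C.thetaModel h d12 d34).t12 V c) 0 1)
    (coreAll34 : ∀ {L : CMField} {ι₁ : L →+* ℂ} (V : HermSpace3 L ι₁) (c : SeesawCtx L),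
      (C.thetaModel h d12 d34).GoodCtx ι₁ c →
        N19g_coreAll (C.thetaModel h d12 d34) V c ((C.thetaModel h d12 d34).t34 V c) 2 3)
    (A12 : ∀ {L : CMField} {ι₁ : L →+* ℂ} (V : HermSpace3 L ι₁) (c : SeesawCtx L),
      (C.thetaModel h d12 d34).GoodCtx ι₁ c →
        Nonempty ((C.toCore h).LinSmoothCore12 ((C.toCore h).side12 d12) ((C.toCore h).side34 d34)
          ((C.toCore h).analyticKM ((C.toCore h).side12 d12) ((C.toCore h).side34 d34)).toAnalytic V c
          (ℓ := lin V c)))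
    (A34 : ∀ {L : CMField} {ι₁ : L →+* ℂ} (V : HermSpace3 L ι₁) (c : SeesawCtx L),
      (C.thetaModel h d12 d34).GoodCtx ι₁ c →
        Nonempty ((C.toCore h).LinSmoothCore34 ((C.toCore h).side12 d12) ((C.toCore h).side34 d34)
          ((C.toCore h).analyticKM ((C.toCore h).side12 d12) ((C.toCore h).side34 d34)).toAnalytic V c
          (ℓ := lin V c)))
    (hHR : U.Fact_hodgeRiemann20) : U.PerL :=
  perL_ofSignRecipe₇_ofCores U M h C d12 d34
    (C.coresNonDesign_thetaModel_of_linSmoothCores h d12 d34 lin embCover innerEmb thetaSub thetaWedge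
      genIdentity12 coreAll34 A12 A34) hHR

/-- **COR-CM, END STATE with every residual form applied** (hypotheses: `M`, M29/M30, the three [QW8]-side inputs,
`h`, `C`, `d12`/`d34`, `lin`, the four verbatim inputs, the two N19 cores, `A12`/`A34`, Hodge–Riemann). -/
theorem COR_CM_endState_ofSignRecipe₇_ofCores_linSmooth (M : U.ModelAxioms) (h29 : U.Fact_weightSpan)
    (h30 : U.Fact_weightHodge) (hE : U.Qw8ExtProd) (hD : U.Qw8DualPushPull) (hMi : U.Qw8Milne) (h : Bool)
    (C : U.AdelicThetaCore₀) (d12 d34 : ∀ {L : CMField}, SeesawCtx L → SideData L)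
    (lin : ∀ {L : CMField} {ι₁ : L →+* ℂ} (V : HermSpace3 L ι₁) (c : SeesawCtx L), ((C.toCore h).wm V c).LinearStr)
    (embCover : (C.thetaModel h d12 d34).Fact_embCover) (innerEmb : (C.thetaModel h d12 d34).Fact_innerEmb)
    (thetaSub : (C.thetaModel h d12 d34).Open_thetaSub) (thetaWedge : (C.thetaModel h d12 d34).Open_thetaWedge)
    (genIdentity12 : ∀ {L : CMField} {ι₁ : L →+* ℂ} (V : HermSpace3 L ι₁) (c : SeesawCtx L),
      (C.thetaModel h d12 d34).GoodCtx ι₁ c →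
        N19w_genIdentity (C.thetaModel h d12 d34) V c ((C.thetaModel h d12 d34).t12 V c) 0 1)
    (coreAll34 : ∀ {L : CMField} {ι₁ : L →+* ℂ} (V : HermSpace3 L ι₁) (c : SeesawCtx L),
      (C.thetaModel h d12 d34).GoodCtx ι₁ c →
        N19g_coreAll (C.thetaModel h d12 d34) V c ((C.thetaModel h d12 d34).t34 V c) 2 3)
    (A12 : ∀ {L : CMField} {ι₁ : L →+* ℂ} (V : HermSpace3 L ι₁) (c : SeesawCtx L),
      (C.thetaModel h d12 d34).GoodCtx ι₁ c →
        Nonempty ((C.toCore h).LinSmoothCore12 ((C.toCore h).side12 d12) ((C.toCore h).side34 d34)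
          ((C.toCore h).analyticKM ((C.toCore h).side12 d12) ((C.toCore h).side34 d34)).toAnalytic V c
          (ℓ := lin V c)))
    (A34 : ∀ {L : CMField} {ι₁ : L →+* ℂ} (V : HermSpace3 L ι₁) (c : SeesawCtx L),
      (C.thetaModel h d12 d34).GoodCtx ι₁ c →
        Nonempty ((C.toCore h).LinSmoothCore34 ((C.toCore h).side12 d12) ((C.toCore h).side34 d34)
          ((C.toCore h).analyticKM ((C.toCore h).side12 d12) ((C.toCore h).side34 d34)).toAnalytic V c
          (ℓ := lin V c)))
    (hHR : U.Fact_hodgeRiemann20) : U.HC_CM :=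
  (C.thetaModel h d12 d34).COR_CM_endState_ofCores M h29 h30 hE hD hMi
    (C.coresNonDesign_thetaModel_of_linSmoothCores h d12 d34 lin embCover innerEmb thetaSub thetaWedge
      genIdentity12 coreAll34 A12 A34)
    (C.design_kappaConj h d12 d34) (C.design_frameSignConj h d12 d34) hHR

end Assembly

end HodgeCM

end
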